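import Summits.NavierStokesRegularity.NavierStokesRegularity.Theses.SymmetryModuliCount
import Literature.Analysis.FluidPDE.TypeIAncientMild
import Literature.Analysis.FluidPDE.LocalTypeI
import Literature.Analysis.FluidPDE.SpaceTimeRescaling
import Summits.NavierStokesRegularity.NavierStokesRegularity.Theorems.SymmetryModuliCountAxisymEndLiouvilleOfFarPastLedgerAssembly
import Summits.NavierStokesRegularity.NavierStokesRegularity.Theorems.SymmetryModuliCountAxisymEndLiouvilleOfFarPastLedgerPressure
import Summits.NavierStokesRegularity.NavierStokesRegularity.Theorems.SymmetryModuliCountAxisymEndLiouvilleOfFarPastLedgerCubic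
import Summits.NavierStokesRegularity.NavierStokesRegularity.Theorems.SymmetryModuliCountFarPastLedgerCovering
import Summits.NavierStokesRegularity.NavierStokesRegularity.Theorems.SymmetryModuliCountFarPastLedgerFarShell
import Summits.NavierStokesRegularity.NavierStokesRegularity.Theorems.SymmetryModuliCountFarPastLedgerPressureGradientBound
import Summits.NavierStokesRegularity.NavierStokesRegularity.Theorems.SymmetryModuliCountFarPastLedgerPinning
import Summits.NavierStokesRegularity.NavierStokesRegularity.Theorems.SymmetryModuliCountFarPastLedgerMeanDisplacement
import Summits.NavierStokesRegularity.NavierStokesRegularity.Theorems.SymmetryModuliCountForcedSymmetryStubBlowDownDriver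
import Summits.NavierStokesRegularity.NavierStokesRegularity.Theorems.SymmetryModuliCountForcedSymmetrySelfSimilarVertexLeaf

/-!
# `ForcedSymmetry` (stmt-NavierStokesRegularity-4052), line `blow-down-census`: the reduction, importable

Route `SymmetryModuliCount`, sub-problem `NavierStokesRegularity`. This file is the sorry-free COMPOSITION of the
lead's registered skeleton `Cruxes/ForcedSymmetry/Lines/blow_down_census.lean` (gen 2, lead c1), with its three open
stubs carried as explicit hypotheses written out verbatim (no local definitions), so that the line's reduction is a
tree theorem now and closes by `modus ponens` when the stubs land:

* `hFPL : FarPastLedger` — route item stmt-NavierStokesRegularity-14060 (its own crux chain);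
* `hHA` — the slice harmonic analysis of the Oseen pressure, verbatim the registered stub `stub_fplSlicePressure`
  of crux 14060's line `uloc-gronwall-transplant`;
* `hSS` — the X-strength bet of this line (`stub_blowDownLimitSelfSimilar`): smooth blow-down limits in `A_C` of
  elements of `A_C ∩ 𝒦` are backward self-similar about the origin.

Everything else is a landed theorem: the near/far window pressure (`nearFar_window_of_parts` fed with the landed
`stub_fplPressureGradientBound`, `stub_fplPinning`, `stub_fplMeanDisplacement`), the pressure package
(`pressurePackage_of_nearFar` fed with `stub_fplFarShell`, `stub_fplCovering`), the cubic bound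
(`lintegral_parabolicCylinder_le`), the general blow-down driver (`ForcedSymmetry.BlowDownCensus.stub_blowDownDriver`,
p96980: singular `L³` limit `U` by A–B Lemma 2.2 / Prop 2.3 = `SuitableCompactness_holds` /
`PersistenceOfSingularities_holds`, smooth limit `W ∈ A_C`, `U = W` a.e. on `Q(0,½)`), and the self-similar leaf at
the vertex `(0,0)` (`selfSimilarOriginVertex_vanishes`, p98310).

* `typeIAncientLiouville_of_ledger_slicePressure_selfSimilarBlowDown` : the three hypotheses ⇒ X (stmt-4050);
* `forcedSymmetry_of_ledger_slicePressure_selfSimilarBlowDown` : the three hypotheses ⇒ the crux (stmt-4052).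

References: Albritton–Barker, ARMA 232 (2019) = arXiv:1811.00502, Lemma 2.2, Prop 2.3, §3 [AlbrittonBarker2019];
KNSS, Acta Math. 203 (2009) [KNSS2009]; Giga–Kohn, CPAM 38 (1985) (the model of `hSS`) [GigaKohn1985].
-/

noncomputable section

-- the summit and its single problem share the name `NavierStokesRegularity` (D-0017 nested layout)
set_option linter.dupNamespace false

open MeasureTheory Set Function Filter Topology TopologicalSpace Metric
open scoped NNReal ENNReal InnerProductSpace

namespace Summit.NavierStokesRegularity.NavierStokesRegularity.Theorems

open Literature.Analysis.FluidPDE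
open Summit.NavierStokesRegularity.NavierStokesRegularity.Theses.SymmetryModuliCount
open Summit.NavierStokesRegularity.NavierStokesRegularity.Theorems.AxisymEndLiouvilleOfFarPastLedger

/-- **Line `blow-down-census`, reduction to its three open stubs: X.** If the far-past ledger holds (route item
`FarPastLedger`), the slice harmonic analysis of the Oseen pressure holds (`hHA`, verbatim crux 14060's
`stub_fplSlicePressure`), and smooth blow-down limits of elements of `A_C ∩ 𝒦` are backward self-similar about the
origin (`hSS`, the line's X-strength bet), then every Type-I KNSS-mild ancient field vanishes
(`TypeIAncientLiouville`, stmt-NavierStokesRegularity-4050). Proof: ledger ⇒ near/far window pressure ⇒ pressure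
package + cubic bound ⇒ blow-down at a point where `u ≠ 0` (landed driver): singular `L³` limit `U` = smooth limit
`W ∈ A_C` a.e. on `Q(0,½)` ⇒ `W` self-similar (`hSS`) ⇒ `W ≡ 0` (vertex leaf) ⇒ `U = 0` a.e. on `Q(0,½)`, not
singular: contradiction. [cite: AlbrittonBarker2019, Lemma 2.2, Prop 2.3 and §3] -/
theorem typeIAncientLiouville_of_ledger_slicePressure_selfSimilarBlowDown :
    FarPastLedger →
    (∃ c₀ : ℝ, 0 ≤ c₀ ∧
      ∀ (M L : ℝ) (w : EuclideanSpace ℝ (Fin 3) → EuclideanSpace ℝ (Fin 3))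
        (q : EuclideanSpace ℝ (Fin 3) → ℝ),
      ContDiff ℝ (⊤ : ℕ∞) w → ContDiff ℝ (⊤ : ℕ∞) q →
      Literature.Analysis.FluidPDE.VectorCalculus.IsDivFree w →
      (∀ x, ‖w x‖ ≤ M) → (∀ x, ‖fderiv ℝ q x‖ ≤ L) →
      (∀ x, Laplacian.laplacian q x =
        -Literature.Analysis.FluidPDE.VectorCalculus.divergence
          (Literature.Analysis.FluidPDE.convect w w) x) →
      ∃ a : EuclideanSpace ℝ (Fin 3),
        (∀ x₀ : EuclideanSpace ℝ (Fin 3), ∃ (c : ℝ) (p₁ p₂ : EuclideanSpace ℝ (Fin 3) → ℝ),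
          (∀ x ∈ Metric.ball x₀ 2, q x = c + inner ℝ a x + p₁ x + p₂ x) ∧
          MeasureTheory.MemLp p₁ 2 MeasureTheory.volume ∧
          ∫ x, p₁ x ^ 2 ≤ c₀ * M ^ 2 * ∫ x in Metric.ball x₀ 4, ‖w x‖ ^ 2 ∧
          ∀ x ∈ Metric.ball x₀ 2, DifferentiableAt ℝ p₂ x ∧
            ‖fderiv ℝ p₂ x‖ ≤ c₀ * ∫ y in (Metric.ball x₀ 3)ᶜ, ‖w y‖ ^ 2 / ‖y - x₀‖ ^ 4) ∧
        ∀ r : ℝ, 1 ≤ r →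
          ‖(∫ x, ((⟨1, 2, zero_lt_one, one_lt_two⟩ : ContDiffBump (0 : EuclideanSpace ℝ (Fin 3))) :
                EuclideanSpace ℝ (Fin 3) → ℝ) (r⁻¹ • x))⁻¹ •
              (∫ x, (((⟨1, 2, zero_lt_one, one_lt_two⟩ :
                  ContDiffBump (0 : EuclideanSpace ℝ (Fin 3))) : EuclideanSpace ℝ (Fin 3) → ℝ)
                    (r⁻¹ • x)) • gradient q x) - a‖ ≤ c₀ * M ^ 2 / r) →
    (∀ (C K : ℝ) (v : ℝ → EuclideanSpace ℝ (Fin 3) → EuclideanSpace ℝ (Fin 3)), IsTypeIAncientMild C v →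
      (∀ t < 0, ∀ (x₀ : EuclideanSpace ℝ (Fin 3)) (R : ℝ), 0 < R →
        ∫ x in ball x₀ R, ‖v t x‖ ^ 2 ≤ K * R) →
      ∀ (t₁ : ℝ) (x₁ : EuclideanSpace ℝ (Fin 3)), t₁ < 0 →
      ∀ (c : ℕ → ℝ), (∀ k, 0 < c k) → Tendsto c atTop atTop →
      ∀ (W : ℝ → EuclideanSpace ℝ (Fin 3) → EuclideanSpace ℝ (Fin 3)), IsTypeIAncientMild C W →
        (∀ s < 0, ∀ y, Tendsto (fun k => c k • v (t₁ + c k ^ 2 * s) (x₁ + c k • y)) atTop (𝓝 (W s y))) →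
        (∀ s < 0, TendstoLocallyUniformly
          (fun k (y : EuclideanSpace ℝ (Fin 3)) => c k • v (t₁ + c k ^ 2 * s) (x₁ + c k • y)) (W s) atTop) →
        ∀ s < 0, ∀ y, fderiv ℝ (W s) y y + W s y + (2 * s) • timeDeriv W s y = 0) →
    TypeIAncientLiouville := by
  intro hFPL hHA hSS C u hu t ht x
  have hA : IsTypeIAncientMild C u := isTypeIAncientMild_iff.2 hu
  by_contra hx
  -- Step 0: the ledger, the slice pressure lemma, the far-shell sum
  obtain ⟨K, hK⟩ := hFPL C
  obtain ⟨c₀, hc₀, hHA⟩ := hHA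
  obtain ⟨cS, hcS0, hS⟩ := stub_fplFarShell
  -- Step 1: near/far structure of the window pressure at the centre `0` on `(-3, 0)`, for the whole class
  have hNF : ∀ w : ℝ → EuclideanSpace ℝ (Fin 3) → EuclideanSpace ℝ (Fin 3), IsTypeIAncientMild C w →
      ∃ p : ℝ → EuclideanSpace ℝ (Fin 3) → ℝ, IsClassicalNSSolutionOn (Ioo (-3) 0) 1 0 w p ∧
        ∀ τ ∈ Ioo (-3 : ℝ) 0, ∃ (c : ℝ) (p₁ p₂ : EuclideanSpace ℝ (Fin 3) → ℝ),
          (∀ x ∈ ball (0 : EuclideanSpace ℝ (Fin 3)) 2, p τ x = c + p₁ x + p₂ x) ∧ MemLp p₁ 2 volume ∧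
          ∫ x, p₁ x ^ 2 ≤ c₀ * (C ^ 2 / (-τ)) * ∫ x in ball (0 : EuclideanSpace ℝ (Fin 3)) 4, ‖w τ x‖ ^ 2 ∧
          ∀ x ∈ ball (0 : EuclideanSpace ℝ (Fin 3)) 2, DifferentiableAt ℝ p₂ x ∧
            ‖fderiv ℝ p₂ x‖ ≤ c₀ * ∫ y in (ball (0 : EuclideanSpace ℝ (Fin 3)) 3)ᶜ,
              ‖w τ y‖ ^ 2 / ‖y - (0 : EuclideanSpace ℝ (Fin 3))‖ ^ 4 := by
    intro w hw
    obtain ⟨p, hp, h⟩ := nearFar_window_of_parts hc₀ stub_fplPressureGradientBound hHA stub_fplPinning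
      stub_fplMeanDisplacement hw (t₀ := (-3 : ℝ)) (by norm_num)
    exact ⟨p, hp, fun τ hτ => h τ hτ 0⟩
  -- Step 2: the pressure package and the cubic bound: `A_C ∩ {ledger K} ⊂ 𝒦`
  obtain ⟨D₀, hPress⟩ := pressurePackage_of_nearFar (K := K) hc₀ hcS0 (hS stub_fplCovering) hNF
  have hcubic : ∀ w : ℝ → EuclideanSpace ℝ (Fin 3) → EuclideanSpace ℝ (Fin 3), IsTypeIAncientMild C w →
      (∀ t < 0, ∀ (x₀ : EuclideanSpace ℝ (Fin 3)) (R : ℝ), 0 < R →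
        ∫ x in ball x₀ R, ‖w t x‖ ^ 2 ≤ K * R) →
      ∫⁻ z in parabolicCylinder 1 (0 : ℝ × EuclideanSpace ℝ (Fin 3)), ‖w z.1 z.2‖ₑ ^ (3 : ℕ) ≤
        ENNReal.ofReal (2 * C * K) := by
    intro w hw hKw
    have key := lintegral_parabolicCylinder_le hw hKw (z := (0 : ℝ × EuclideanSpace ℝ (Fin 3))) le_rfl one_pos
    simpa using key
  -- Step 3: blow-down at `(t, x)`, where `u ≠ 0` (landed driver)
  obtain ⟨t₁, x₁, c, U, W, ht₁, hcpos, hctop, hW, hpt, hlu, hsing, hUW⟩ :=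
    ForcedSymmetry.BlowDownCensus.stub_blowDownDriver C K D₀ hcubic hPress u hA (hK u hA) t x ht hx
  -- Step 4: the smooth blow-down limit is self-similar (the bet), hence zero (vertex leaf)
  have hss := hSS C K u hA (hK u hA) t₁ x₁ ht₁ c hcpos hctop W hW hpt hlu
  have hW0 : ∀ s < 0, ∀ y, W s y = 0 := selfSimilarOriginVertex_vanishes C W hW hss
  -- Step 5: so the singular limit vanishes a.e. on `Q(0, 1/2)`: contradiction
  have hQm : MeasurableSet (parabolicCylinder (1 / 2) (0 : ℝ × EuclideanSpace ℝ (Fin 3))) :=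
    (isOpen_parabolicCylinder _ _).measurableSet
  have hU0 : uncurry U =ᵐ[volume.restrict (parabolicCylinder (1 / 2) (0 : ℝ × EuclideanSpace ℝ (Fin 3)))] 0 := by
    filter_upwards [hUW, ae_restrict_mem hQm] with z hz hzQ
    rw [hz]
    obtain ⟨s, y⟩ := z
    rw [mem_parabolicCylinder] at hzQ
    have hs : s < 0 := by simpa using hzQ.1.2
    simp [hW0 s hs y]
  have h := hsing (1 / 2) (by norm_num)
  rw [eLpNorm_congr_ae hU0, eLpNorm_zero] at h
  exact ENNReal.zero_ne_top h

/-- **Line `blow-down-census`, reduction to its three open stubs: the crux.** Under the same three hypotheses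
(ledger, slice pressure, self-similar blow-down limits) the crux `ForcedSymmetry` (stmt-NavierStokesRegularity-4052)
holds: `A_C = {0}` by the previous theorem, and the zero field has the translation symmetry `ξ = (e₀, 0, 0)`.
[cite: AlbrittonBarker2019, Lemma 2.2, Prop 2.3 and §3] -/
theorem forcedSymmetry_of_ledger_slicePressure_selfSimilarBlowDown :
    FarPastLedger →
    (∃ c₀ : ℝ, 0 ≤ c₀ ∧
      ∀ (M L : ℝ) (w : EuclideanSpace ℝ (Fin 3) → EuclideanSpace ℝ (Fin 3))
        (q : EuclideanSpace ℝ (Fin 3) → ℝ),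
      ContDiff ℝ (⊤ : ℕ∞) w → ContDiff ℝ (⊤ : ℕ∞) q →
      Literature.Analysis.FluidPDE.VectorCalculus.IsDivFree w →
      (∀ x, ‖w x‖ ≤ M) → (∀ x, ‖fderiv ℝ q x‖ ≤ L) →
      (∀ x, Laplacian.laplacian q x =
        -Literature.Analysis.FluidPDE.VectorCalculus.divergence
          (Literature.Analysis.FluidPDE.convect w w) x) →
      ∃ a : EuclideanSpace ℝ (Fin 3),
        (∀ x₀ : EuclideanSpace ℝ (Fin 3), ∃ (c : ℝ) (p₁ p₂ : EuclideanSpace ℝ (Fin 3) → ℝ),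
          (∀ x ∈ Metric.ball x₀ 2, q x = c + inner ℝ a x + p₁ x + p₂ x) ∧
          MeasureTheory.MemLp p₁ 2 MeasureTheory.volume ∧
          ∫ x, p₁ x ^ 2 ≤ c₀ * M ^ 2 * ∫ x in Metric.ball x₀ 4, ‖w x‖ ^ 2 ∧
          ∀ x ∈ Metric.ball x₀ 2, DifferentiableAt ℝ p₂ x ∧
            ‖fderiv ℝ p₂ x‖ ≤ c₀ * ∫ y in (Metric.ball x₀ 3)ᶜ, ‖w y‖ ^ 2 / ‖y - x₀‖ ^ 4) ∧
        ∀ r : ℝ, 1 ≤ r →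
          ‖(∫ x, ((⟨1, 2, zero_lt_one, one_lt_two⟩ : ContDiffBump (0 : EuclideanSpace ℝ (Fin 3))) :
                EuclideanSpace ℝ (Fin 3) → ℝ) (r⁻¹ • x))⁻¹ •
              (∫ x, (((⟨1, 2, zero_lt_one, one_lt_two⟩ :
                  ContDiffBump (0 : EuclideanSpace ℝ (Fin 3))) : EuclideanSpace ℝ (Fin 3) → ℝ)
                    (r⁻¹ • x)) • gradient q x) - a‖ ≤ c₀ * M ^ 2 / r) →
    (∀ (C K : ℝ) (v : ℝ → EuclideanSpace ℝ (Fin 3) → EuclideanSpace ℝ (Fin 3)), IsTypeIAncientMild C v →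
      (∀ t < 0, ∀ (x₀ : EuclideanSpace ℝ (Fin 3)) (R : ℝ), 0 < R →
        ∫ x in ball x₀ R, ‖v t x‖ ^ 2 ≤ K * R) →
      ∀ (t₁ : ℝ) (x₁ : EuclideanSpace ℝ (Fin 3)), t₁ < 0 →
      ∀ (c : ℕ → ℝ), (∀ k, 0 < c k) → Tendsto c atTop atTop →
      ∀ (W : ℝ → EuclideanSpace ℝ (Fin 3) → EuclideanSpace ℝ (Fin 3)), IsTypeIAncientMild C W →
        (∀ s < 0, ∀ y, Tendsto (fun k => c k • v (t₁ + c k ^ 2 * s) (x₁ + c k • y)) atTop (𝓝 (W s y))) →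
        (∀ s < 0, TendstoLocallyUniformly
          (fun k (y : EuclideanSpace ℝ (Fin 3)) => c k • v (t₁ + c k ^ 2 * s) (x₁ + c k • y)) (W s) atTop) →
        ∀ s < 0, ∀ y, fderiv ℝ (W s) y y + W s y + (2 * s) • timeDeriv W s y = 0) →
    ForcedSymmetry := by
  intro hFPL hHA hSS C u hu
  have h0 : ∀ t < 0, ∀ x, u t x = 0 :=
    typeIAncientLiouville_of_ledger_slicePressure_selfSimilarBlowDown hFPL hHA hSS C u hu
  refine ⟨EuclideanSpace.single 0 1, 0, 0, fun x => by simp, fun hh => ?_, fun t ht x => ?_⟩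
  · have h1 : (EuclideanSpace.single (0 : Fin 3) (1 : ℝ) : EuclideanSpace ℝ (Fin 3)) 0 = 1 := by simp
    rw [hh.1] at h1
    simp at h1
  · have hut : u t = fun _ => 0 := funext (h0 t ht)
    simp [hut]

end Summit.NavierStokesRegularity.NavierStokesRegularity.Theorems

end
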